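import Summits.BirchSwinnertonDyer.BirchSwinnertonDyer.Theorems.ThetaPartnerAtTwoSignedMainConjectureCMTwoRankZeroLowerOffTwoPackage
import Summits.BirchSwinnertonDyer.BirchSwinnertonDyer.Theorems.ResidualThetaTransportAtTwoLambdaLowerBoundOWeierstrass
import Summits.BirchSwinnertonDyer.BirchSwinnertonDyer.Theorems.ResidualThetaTransportAtTwoLambdaLowerBoundO
import Literature.NumberTheory.EllipticCurves.Kato2004.ZetaQuotientPackageCoeff
import HarnessLib

/-!
# Sketch — stub-ideation k = 2 (literature transfer, typed dictionary) for the registered stub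
# `stub_cmLambdaLower` (S2) of `Cruxes/ResidualThetaCountLowerPureAtTwo/Lines/bt26_lambda.lean` (v5)

Scratch file of seat `planner-sidea-stub_cmLambdaLower-2-g0-0`. It TYPES the helper lemmas of the idea card
`Ideas/stub_cmLambdaLower-k2.md` and proves, sorry-free, the KERNEL COMPOSITION of the top plan
(«length road ⊗ 𝒪»): from a LOWER Coleman–Poitou–Tate package at a height-one prime `𝔭 ∌ 𝒪∖0` of
`Λ_𝒪 = 𝒪⟦X⟧` and Burungale–Tian Thm. 2.6 read prime-by-prime, `ℓ_𝔭(Λ_𝒪/(L⁻)) ≤ ℓ_𝔭(X⁺_g)`; then the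
λ-reading `d ≤ rank_𝒪(X⁺_g / tors)` and the count `q^(d+Σ) ≤ #(X⁺_{S₀}/ϖ)`.
Named `def … : Prop` items are helper-lemma SIGNATURES (nothing asserted); theorems are proved.
Nothing about any curve, form or Selmer group is asserted; the stub is NOT proved; BSD is NOT proved by any of this.
-/

set_option autoImplicit false
set_option linter.dupNamespace false

noncomputable section

open scoped Classical

namespace Summit.BirchSwinnertonDyer.BirchSwinnertonDyer.Cruxes.ResidualThetaCountLowerPureAtTwo.StubIdeasK2

open Literature.NumberTheory.EllipticCurves Literature.NumberTheory.EllipticCurves.Kato2004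
  Literature.NumberTheory.GaloisRepresentations Literature.NumberTheory.Automorphic
  Literature.NumberTheory.EllipticCurves.Module
  Summit.BirchSwinnertonDyer.BirchSwinnertonDyer.Theorems

/-! ## §1 Helper-lemma signatures (provable commutative algebra; no research content) -/

/-- **H1 `LengthEqOffConstants`** — «a characteristic-ideal identity UP TO CONSTANTS is read prime by prime
off the constants»: over `R⟦X⟧` (Noetherian UFD), if `(C c)·char M = (C d)·char N` with `c, d ≠ 0`, then
`ℓ_𝔭(M) = ℓ_𝔭(N)` at every height-one `𝔭` containing no non-zero constant. Generalises
`SkinnerUrban2014.lengthAt_eq_of_charIdeal_eq` (the case `c = d = 1`); proof: `exists_charIdeal_eq_span_prod`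
+ `lengthAt_quotient_span_singleton_eq_ord`-style bookkeeping, the factor `C c` having `ℓ_𝔭 = 0`. -/
def LengthEqOffConstants : Prop :=
  ∀ (R : Type) [CommRing R] [IsDomain R] [IsNoetherianRing (PowerSeries R)]
    [UniqueFactorizationMonoid (PowerSeries R)]
    (M N : Type) [AddCommGroup M] [Module (PowerSeries R) M] [Module.Finite (PowerSeries R) M]
    [AddCommGroup N] [Module (PowerSeries R) N] [Module.Finite (PowerSeries R) N],
    Module.IsTorsion (PowerSeries R) M → Module.IsTorsion (PowerSeries R) N →
    ∀ c d : R, c ≠ 0 → d ≠ 0 →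
      Ideal.span {PowerSeries.C c} * charIdeal (PowerSeries R) M =
        Ideal.span {PowerSeries.C d} * charIdeal (PowerSeries R) N →
      ∀ 𝔭 : PrimeSpectrum (PowerSeries R), 𝔭.asIdeal.height = 1 →
        (∀ a : R, a ≠ 0 → PowerSeries.C a ∉ 𝔭.asIdeal) →
        lengthAt (PowerSeries R) M 𝔭 = lengthAt (PowerSeries R) N 𝔭

/-- **H1′ `PackageLengthEqOffConstants`** — H1 applied to the typed Burungale–Tian currency: for a
`Kato2004.ZetaQuotientPackage K` on a pinned `𝐇¹_Γ(T)`-datum `I` with coefficients `A`,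
`K.CharIdealEqUpToConst ⇒ ℓ_𝔭(𝐇²) = ℓ_𝔭(𝐇¹/Z)` at every height-one `𝔭 ∌ A∖0` of `A⟦X⟧`. -/
def PackageLengthEqOffConstants : Prop :=
  ∀ (A : Type) [CommRing A] [TopologicalSpace A] (M : Type) [AddCommGroup M] [Module A M]
    [TopologicalSpace M] [IsTopologicalAddGroup M] [ContinuousSMul A M]
    (T : GaloisRep ℚ A M) (p : ℕ) [Fact p.Prime] (κ : ZpExtension ℚ p) (γ : Field.absoluteGaloisGroup ℚ)
    (I : IwasawaH1DataCoeff T p κ γ) (K : ZetaQuotientPackage I)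
    [IsDomain A] [IsNoetherianRing (PowerSeries A)] [UniqueFactorizationMonoid (PowerSeries A)]
    [Module.Finite (PowerSeries A) I.H],
    K.CharIdealEqUpToConst →
    ∀ 𝔭 : PrimeSpectrum (PowerSeries A), 𝔭.asIdeal.height = 1 →
      (∀ a : A, a ≠ 0 → PowerSeries.C a ∉ 𝔭.asIdeal) →
      lengthAt (PowerSeries A) K.H2 𝔭 = lengthAt (PowerSeries A) K.zetaQuotient 𝔭

/-- H1 ⇒ H1′ (bookkeeping). -/
theorem packageLengthEqOffConstants_of_lengthEqOffConstants (h : LengthEqOffConstants) :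
    PackageLengthEqOffConstants := by
  intro A _ _ M _ _ _ _ _ T p _ κ γ I K _ _ _ _ hK 𝔭 h𝔭 hc𝔭
  haveI : Module.Finite (PowerSeries A) K.H2 := K.finite_H2
  obtain ⟨c, d, hc, hd, hcd⟩ := hK.exists_const_mul_eq
  exact h A K.H2 K.zetaQuotient K.isTorsion_H2 K.isTorsion_zetaQuotient c d hc hd hcd 𝔭 h𝔭 hc𝔭

/-- **H2 `FinrankMonoOfLengthLe`** — «λ is read off the height-one lengths away from `ϖ`»: for finitely
generated torsion `Λ_𝒪 = 𝒪⟦X⟧`-modules `X, Y` (`𝒪 = padicCoeffIntegers S`, a DVR), if `ℓ_𝔭(X) ≤ ℓ_𝔭(Y)` at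
every height-one `𝔭 ∌ 𝒪∖0`, then `rank_𝒪(X/X_tors) ≤ rank_𝒪(Y/Y_tors)`. (Both sides equal
`Σ_{𝔭 ∌ ϖ} ℓ_𝔭 · rank_𝒪(Λ/𝔭)`: structure theory of `X[1/ϖ]` over the PID `Λ_𝒪[1/ϖ]`, Washington §13.2; the
`ℤ_p` equality form is the tree's `IwasawaAlgebra.lambdaInvariant_eq_sum_natDegree`.) -/
def FinrankMonoOfLengthLe : Prop :=
  ∀ (p : ℕ) [Fact p.Prime] (S : Set (PadicAlgCl p)) [FiniteDimensional ℚ_[p] (padicCoeffField S)]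
    (X Y : Type) [AddCommGroup X] [Module (IwasawaAlgebraO S) X] [Module (padicCoeffIntegers S) X]
    [IsScalarTower (padicCoeffIntegers S) (IwasawaAlgebraO S) X] [Module.Finite (IwasawaAlgebraO S) X]
    [AddCommGroup Y] [Module (IwasawaAlgebraO S) Y] [Module (padicCoeffIntegers S) Y]
    [IsScalarTower (padicCoeffIntegers S) (IwasawaAlgebraO S) Y] [Module.Finite (IwasawaAlgebraO S) Y],
    Module.IsTorsion (IwasawaAlgebraO S) X → Module.IsTorsion (IwasawaAlgebraO S) Y →
    (∀ 𝔭 : PrimeSpectrum (IwasawaAlgebraO S), 𝔭.asIdeal.height = 1 →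
      (∀ a : padicCoeffIntegers S, a ≠ 0 → PowerSeries.C a ∉ 𝔭.asIdeal) →
      lengthAt (IwasawaAlgebraO S) X 𝔭 ≤ lengthAt (IwasawaAlgebraO S) Y 𝔭) →
    Module.finrank (padicCoeffIntegers S) (X ⧸ Submodule.torsion (padicCoeffIntegers S) X) ≤
      Module.finrank (padicCoeffIntegers S) (Y ⧸ Submodule.torsion (padicCoeffIntegers S) Y)

/-! ## §2 The research package (𝒪-version of TP2's `offTwoLower_of_lowerColemanPackageTwo` hypothesis,
with Kato's `𝐇²` entering through the typed Burungale–Tian package) -/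

/-- **`LowerPackageAt`** — at ONE prime `𝔭` of a commutative ring `Λ`: the LOWER Coleman–Poitou–Tate
package linking a pinned `𝐇¹`-module `H` with zeta submodule `Z`, Kato's `𝐇²` (abstract `H2`), a signed
dual `X` («`X⁺_g`»), a fine dual `X0` («`X₀(A_g/ℚ_∞)`») and a signed `p`-adic `L`-function `L` («`L⁻ = Lm`»):
a submodule `P ≤ Λ` («`Im Col⁺`») with `col : H ↪ P` («`Col⁺ ∘ loc₂`», injective), `j : P → X`,
`k : X ↠ X0` with `ker j ≤ range col` (the DEEP Poitou–Tate half), `k ∘ j = 0`, `ℓ_𝔭(Λ/P) = 0` («`Col⁺` onto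
at `𝔭`»), `s ∈ H` («`z_γ⁺(g)`») with `ℓ_𝔭(Λ/(L)) ≤ ℓ_𝔭(Λ/(col s))` («`L⁻ ∣ Col⁺(z)` at `𝔭`»: Kato 12.5 (1) +
Otsuki/Kobayashi ERL + Pollack interpolation), `Z ≤ Λ·s` (Kato Thm. 12.5: `Z` cyclic on the `κ`-component)
and `ℓ_𝔭(𝐇²) ≤ ℓ_𝔭(X0)` (Kurihara's Prop. 7.1 ii) analogue, `⊗ ℚ`). Nothing asserted. -/
def LowerPackageAt {Λ : Type} [CommRing Λ] (H : Type) [AddCommGroup H] [Module Λ H]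
    (Z : Submodule Λ H) (H2 : Type) [AddCommGroup H2] [Module Λ H2]
    (X : Type) [AddCommGroup X] [Module Λ X] (X0 : Type) [AddCommGroup X0] [Module Λ X0]
    (L : Λ) (𝔭 : PrimeSpectrum Λ) : Prop :=
  ∃ (P : Submodule Λ Λ) (col : H →ₗ[Λ] P) (j : P →ₗ[Λ] X) (k : X →ₗ[Λ] X0) (s : H),
    Function.Injective col ∧ LinearMap.ker j ≤ LinearMap.range col ∧ (∀ x, k (j x) = 0) ∧
    Function.Surjective k ∧
    lengthAt Λ (Λ ⧸ P) 𝔭 = 0 ∧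
    lengthAt Λ (Λ ⧸ Ideal.span {(P.subtype (col s) : Λ)}) 𝔭 ≥ lengthAt Λ (Λ ⧸ Ideal.span {L}) 𝔭 ∧
    Z ≤ Submodule.span Λ {s} ∧
    lengthAt Λ H2 𝔭 ≤ lengthAt Λ X0 𝔭

/-- **Kernel composition of the top plan at one prime** (any commutative ring): Burungale–Tian read at `𝔭`
(`hBT : ℓ_𝔭(𝐇²) = ℓ_𝔭(H/Z)`) + the lower package at `𝔭` + `ℓ_𝔭(X) < ⊤` ⇒ `ℓ_𝔭(Λ/(L)) ≤ ℓ_𝔭(X)` — by the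
landed reverse four-term inequality `SignedLowerOffTwo.lengthAt_quotient_le_of_fourTerm_ge` (TP2, any `R`). -/
theorem lengthAt_quotient_le_of_lowerPackageAt {Λ : Type} [CommRing Λ] {H : Type} [AddCommGroup H]
    [Module Λ H] {Z : Submodule Λ H} {H2 : Type} [AddCommGroup H2] [Module Λ H2]
    {X : Type} [AddCommGroup X] [Module Λ X] {X0 : Type} [AddCommGroup X0] [Module Λ X0]
    {L : Λ} {𝔭 : PrimeSpectrum Λ}
    (hBT : lengthAt Λ H2 𝔭 = lengthAt Λ (H ⧸ Z) 𝔭)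
    (hPkg : LowerPackageAt H Z H2 X X0 L 𝔭) (hX : lengthAt Λ X 𝔭 ≠ ⊤) :
    lengthAt Λ (Λ ⧸ Ideal.span {L}) 𝔭 ≤ lengthAt Λ X 𝔭 := by
  obtain ⟨P, col, j, k, s, hcol, hjc, hkj, hk, hcoker, hdiv, hZs, hKur⟩ := hPkg
  -- `ℓ_𝔭(H/Λs) ≤ ℓ_𝔭(H/Z) = ℓ_𝔭(𝐇²) ≤ ℓ_𝔭(X₀)`
  have hz : lengthAt Λ (H ⧸ Submodule.span Λ {s}) 𝔭 ≤ lengthAt Λ X0 𝔭 :=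
    ((lengthAt_le_of_surjective (Submodule.factor hZs) (Submodule.factor_surjective hZs) 𝔭).trans
      hBT.ge).trans hKur
  have hY : lengthAt Λ X0 𝔭 ≠ ⊤ := ne_top_of_le_ne_top hX (lengthAt_le_of_surjective k hk 𝔭)
  have hrange : LinearMap.range P.subtype = P := P.range_subtype
  have hcoker' : lengthAt Λ (Λ ⧸ LinearMap.range P.subtype) 𝔭 = 0 := by
    rw [lengthAt_eq_of_linearEquiv (Submodule.quotEquivOfEq _ _ hrange) 𝔭]; exact hcoker
  exact SignedLowerOffTwo.lengthAt_quotient_le_of_fourTerm_ge P.subtype P.injective_subtype col hcol j k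
    hjc hkj hk s 𝔭 hcoker' hdiv hz hY

/-! ## §3 The λ-reading and the count over `𝒪 = padicCoeffIntegers S` -/

section OverO

variable (p : ℕ) [Fact p.Prime] (S : Set (PadicAlgCl p)) [FiniteDimensional ℚ_[p] (padicCoeffField S)]

omit [FiniteDimensional ℚ_[p] (padicCoeffField S)] in
/-- `Λ_𝒪/(L)` is `Λ_𝒪`-torsion for `L ≠ 0`. -/
theorem isTorsion_quotient_span_singleton {L : IwasawaAlgebraO S} (hL : L ≠ 0) :
    Module.IsTorsion (IwasawaAlgebraO S) (IwasawaAlgebraO S ⧸ Ideal.span {L}) := by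
  intro x
  induction x using Submodule.Quotient.induction_on with
  | H y =>
    refine ⟨⟨L, mem_nonZeroDivisors_of_ne_zero hL⟩, ?_⟩
    change Submodule.Quotient.mk (p := Ideal.span {L}) (L • y) = 0
    rw [Submodule.Quotient.mk_eq_zero, smul_eq_mul]
    exact Ideal.mul_mem_right _ _ (Ideal.mem_span_singleton_self L)

/-- **λ-reading.** H2 + the length inequalities away from the constants + the crux's norm-λ
normalisation of `L⁻` (`d` = Weierstrass degree; p625410) ⇒ `d ≤ rank_𝒪(X/X_tors)`. -/
theorem le_finrank_quotientTorsion_of_lengthLower (hH2 : FinrankMonoOfLengthLe)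
    (X : Type) [AddCommGroup X] [Module (IwasawaAlgebraO S) X] [Module (padicCoeffIntegers S) X]
    [IsScalarTower (padicCoeffIntegers S) (IwasawaAlgebraO S) X] [Module.Finite (IwasawaAlgebraO S) X]
    (hXt : Module.IsTorsion (IwasawaAlgebraO S) X)
    (Lm : IwasawaAlgebraO S) (d : ℕ) (hL : Lm ≠ 0)
    (hle : ∀ k : ℕ, ‖PowerSeries.coeff k (iwasawaOToPowerSeries S Lm)‖ ≤
      ‖PowerSeries.coeff d (iwasawaOToPowerSeries S Lm)‖)
    (hlt : ∀ k : ℕ, k < d → ‖PowerSeries.coeff k (iwasawaOToPowerSeries S Lm)‖ <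
      ‖PowerSeries.coeff d (iwasawaOToPowerSeries S Lm)‖)
    (hlen : ∀ 𝔭 : PrimeSpectrum (IwasawaAlgebraO S), 𝔭.asIdeal.height = 1 →
      (∀ a : padicCoeffIntegers S, a ≠ 0 → PowerSeries.C a ∉ 𝔭.asIdeal) →
      lengthAt (IwasawaAlgebraO S) (IwasawaAlgebraO S ⧸ Ideal.span {Lm}) 𝔭 ≤
        lengthAt (IwasawaAlgebraO S) X 𝔭) :
    d ≤ Module.finrank (padicCoeffIntegers S) (X ⧸ Submodule.torsion (padicCoeffIntegers S) X) := by
  have h := hH2 p S (IwasawaAlgebraO S ⧸ Ideal.span {Lm}) X (isTorsion_quotient_span_singleton p S hL)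
    hXt hlen
  rwa [LambdaLowerBoundO.finrank_quotientTorsion_quotient_span_eq_of_normLambda_iwasawaAlgebraO p S Lm d
    hL hle hlt] at h

/-- **The count.** `d ≤ rank_𝒪(X/X_tors)`, the imprimitive increment `rank_𝒪(X_{S₀}/tors) = rank_𝒪(X/tors) + Σ`
(Greenberg–Vatsal `⊗ ℚ`, the local terms by p627158) and the brick `q^{rank_𝒪} ≤ #(·/ϖ)` (p624860) ⇒
`q^(d+Σ) ≤ #(X_{S₀}/ϖ X_{S₀})` in `ℕ∞` — the stub's conclusion once `#Sel⁺_{S₀}[ϖ] = #(X_{S₀}/ϖ)` (Pontryagin). -/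
theorem pow_le_natCard_quotient_of_le_finrank (ϖ : padicCoeffIntegers S) (hϖ : Irreducible ϖ)
    (X XS : Type) [AddCommGroup X] [Module (IwasawaAlgebraO S) X] [Module (padicCoeffIntegers S) X]
    [IsScalarTower (padicCoeffIntegers S) (IwasawaAlgebraO S) X] [Module.Finite (IwasawaAlgebraO S) X]
    [AddCommGroup XS] [Module (IwasawaAlgebraO S) XS] [Module (padicCoeffIntegers S) XS]
    [IsScalarTower (padicCoeffIntegers S) (IwasawaAlgebraO S) XS] [Module.Finite (IwasawaAlgebraO S) XS]
    [Finite (XS ⧸ ((Ideal.span {ϖ}) • ⊤ : Submodule (padicCoeffIntegers S) XS))]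
    (d e : ℕ) (hq : 0 < Nat.card (padicCoeffIntegers S ⧸ Ideal.span {ϖ}))
    (hd : d ≤ Module.finrank (padicCoeffIntegers S) (X ⧸ Submodule.torsion (padicCoeffIntegers S) X))
    (himp : Module.finrank (padicCoeffIntegers S) (XS ⧸ Submodule.torsion (padicCoeffIntegers S) XS) =
      Module.finrank (padicCoeffIntegers S) (X ⧸ Submodule.torsion (padicCoeffIntegers S) X) + e) :
    ((Nat.card (padicCoeffIntegers S ⧸ Ideal.span {ϖ}) ^ (d + e) : ℕ) : ℕ∞) ≤
      (Nat.card (XS ⧸ ((Ideal.span {ϖ}) • ⊤ : Submodule (padicCoeffIntegers S) XS)) : ℕ∞) := by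
  obtain ⟨-, hbrick⟩ :=
    LambdaLowerBoundO.pow_finrank_le_natCard_quotient_of_iwasawaAlgebraO p S ϖ hϖ XS
  have hexp : d + e ≤
      Module.finrank (padicCoeffIntegers S) (XS ⧸ Submodule.torsion (padicCoeffIntegers S) XS) := by
    omega
  exact_mod_cast (Nat.pow_le_pow_right hq hexp).trans hbrick

end OverO

end Summit.BirchSwinnertonDyer.BirchSwinnertonDyer.Cruxes.ResidualThetaCountLowerPureAtTwo.StubIdeasK2

end
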